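import Literature.Analysis.FluidPDE.StokesTorusBilinearForm
import Summits.AnomalousDissipation.AnomalousDissipation.Theorems.BaireTransferDenseLoudDesignerForcesErgodicLine

/-!
# The bounded bilinear form of the mild NS formulation on `Hsp` (tools stub S3 `stub_mildBilinearFormTools`,
# block N-R of the line `ergodic-budget-selection-closing`, crux `BaireTransfer.DenseLoudDesignerForces`,
# stmt-AnomalousDissipation-1143)

Summit-side wrapper of the Literature construction `Torus.exists_mildBilinearForm`
(`Literature/Analysis/FluidPDE/StokesTorusBilinearForm.lean`) at `d = Fin 3`, in the line vocabulary
`Hsp = Torus.energySpace (Fin 3)`, `rep v = ⇑↑v` (`…ErgodicLine.lean`): for a Hilbert basis `b` of `Hsp`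
of Stokes modes with eigenvalues `m` and the frame operator `S = (1 + A)^{-1/2}` (`S (b i) = (1 + m i)^{-1/2} b i`,
tools stub S1), there is a continuous bilinear map `Nb : Hsp →L[ℝ] Hsp →L[ℝ] Hsp` — the operator
`(y, z) ↦ A^{-3/4} (1 + A)^{1/2} P B(S y, S z)` of the mild formulation — whose mode coefficients are
`⟪Nb y z, b i⟫ = -(mᵢ^{-3/4}(1 + mᵢ)^{1/2}) ∫ ⟪rep (S z), (rep (S y)·∇) φᵢ⟫` for every representation
`b i = stokesModeL2 k a c`, `φᵢ = stokesMode k a c`.  Boundedness is the Fujita–Kato / Constantin–Foias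
estimate `‖A^{-1/4} P B(u, w)‖ ≤ C ‖A^{1/2} u‖ ‖A^{1/2} w‖`, proved on the Fourier side through the
lattice product law `H¹ · H¹ ⊂ H^{1/2}` on `ℤ³` (`Literature/Analysis/FunctionSpaces/TorusLatticeProductLaw.lean`).

References: Constantin–Foias, *Navier–Stokes Equations* (1988), Ch. 6, (6.9)–(6.10), (6.19);
Fujita–Kato, Arch. Rational Mech. Anal. 16 (1964), Lemma 1.3–1.4.
-/

-- `Summit.<Summit>.<Problem>` is the tree's mandated summit-side namespace (CONVENTIONS §2); for this
-- single-conjunct summit the two coincide, so the duplicate is deliberate.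
set_option linter.dupNamespace false

noncomputable section

open scoped BigOperators Topology ENNReal InnerProductSpace
open Filter Set Function MeasureTheory

namespace Summit.AnomalousDissipation.AnomalousDissipation.Theorems.DenseLoudDesignerForces.Ergodic

open Literature.Analysis.FunctionSpaces Literature.Analysis.FunctionSpaces.Torus
open Literature.Analysis.FluidPDE Literature.Analysis.FluidPDE.Torus
open scoped InnerProductSpace RealInnerProductSpace

/-- **Tools stub S3 (`stub_mildBilinearFormTools`): the bounded bilinear form of the mild
Navier–Stokes formulation on `Hsp`.**  For a Hilbert basis `b` of `Hsp` of Stokes modes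
(`b i = stokesModeL2 kᵢ aᵢ cᵢ`, `kᵢ ≠ 0`, `0 ≠ aᵢ ⊥ kᵢ`, `m i = 4π²|kᵢ|²`) and `S : Hsp →L[ℝ] Hsp` with
`S (b i) = (1 + m i)^{-1/2} b i`, there is `Nb : Hsp →L[ℝ] Hsp →L[ℝ] Hsp` with
`⟪Nb y z, b i⟫ = -(mᵢ^{-3/4} (1 + mᵢ)^{1/2}) ∫ ⟪rep (S z) x, ((rep (S y))·∇)(stokesMode k a c) x⟫ dx`
whenever `b i = stokesModeL2 k a c` — `Nb(y, z) = A^{-3/4} (1 + A)^{1/2} P B(S y, S z)` in mode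
coordinates (`Torus.exists_mildBilinearForm` at `d = Fin 3`; Constantin–Foias 1988, Ch. 6,
(6.9)–(6.10), (6.19); Fujita–Kato 1964). [cite: ConstantinFoiasNSE1988, Ch. 6 (6.9)–(6.10)] -/
theorem stub_mildBilinearFormTools (ι : Type) (b : HilbertBasis ι ℝ Hsp) (m : ι → ℝ)
    (hb : ∀ i, ∃ (k : Fin 3 → ℤ) (a : EuclideanSpace ℝ (Fin 3)) (c : Bool), k ≠ 0 ∧ a ≠ 0 ∧ ⟪latticeVec k, a⟫_ℝ = 0 ∧
      ((b i : Hsp) : Lp (EuclideanSpace ℝ (Fin 3)) 2 (volume : Measure (UnitAddTorus (Fin 3)))) = stokesModeL2 k a c ∧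
      m i = stokesEigenvalue k)
    (S : Hsp →L[ℝ] Hsp) (hS : ∀ i, S (b i) = ((1 + m i) ^ (-(1 / 2 : ℝ))) • b i) :
    ∃ Nb : Hsp →L[ℝ] Hsp →L[ℝ] Hsp, ∀ (y z : Hsp) (i : ι) (k : Fin 3 → ℤ) (a : EuclideanSpace ℝ (Fin 3)) (c : Bool),
      ((b i : Hsp) : Lp (EuclideanSpace ℝ (Fin 3)) 2 (volume : Measure (UnitAddTorus (Fin 3)))) = stokesModeL2 k a c →
      ⟪Nb y z, b i⟫_ℝ = -((m i) ^ (-(3 / 4 : ℝ)) * (1 + m i) ^ (1 / 2 : ℝ)) *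
        ∫ x, ⟪rep (S z) x, convect (rep (S y)) (stokesMode k a c) x⟫_ℝ :=
  exists_mildBilinearForm (Fintype.card_fin 3) ι b m hb S hS

end Summit.AnomalousDissipation.AnomalousDissipation.Theorems.DenseLoudDesignerForces.Ergodic

end
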